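import Summits.Ventures.Crystal3D.Theorems.StickyWulffConstantPolycrystalWulffBoundDominantArith

/-!
# `PolycrystalWulffBound`: arithmetic of the TWO-CLASS twin-free rung (line `PolyDensity`)

Route `StickyWulffConstant` of the venture `Summits/Ventures/Crystal3D`, crux `PolycrystalWulffBound`
(item `stmt-Ventures-19482`), second prover lane (poly-p2, gen 3).  Pure real arithmetic:

* `sqrt_five_lower'` — `2.236 ≤ √5`; `cbrt_bound_of_cube_le` — `a³ ≤ x ⇒ a ≤ x^{1/3}`;
* `rpow_two_thirds_two_classes` — for `V = v₁ + v₂` with both `v_i ≥ (3/20)·V`: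
  `((17/20)^{2/3} + (3/20)^{2/3}) · V^{2/3} ≤ v₁^{2/3} + v₂^{2/3}` (concavity of `t^{2/3}`);
* `twoClass_arith` — the balanced case of the two-class rung: from the intersection-body bound
  `3·V_K^{1/3}·V^{2/3} + D/2 ≤ En` with `V_K ≥ 27.5`, the second pincer
  `w(v₁) + w(v₂) − (√5 − 1/2)·D ≤ En`, and both classes `≥ (3/20)·V`: `w(V) ≤ En`,
  `w(v) = 6·2^{1/3}(√2 v)^{2/3}` (eliminate `D` with weights `2√5 − 1 : 1`; margin `0.16 %`).
WHAT THIS IS NOT: geometry; F-C1 not moved.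
-/

noncomputable section

namespace Summit.Ventures.Crystal3D.Theorems

/-- `2.236 ≤ √5`. -/
theorem sqrt_five_lower' : (2.236 : ℝ) ≤ Real.sqrt 5 := by
  rw [show (2.236 : ℝ) = Real.sqrt (2.236 ^ 2) by rw [Real.sqrt_sq (by norm_num)]]
  exact Real.sqrt_le_sqrt (by norm_num)

/-- If `0 ≤ a` and `a³ ≤ x` then `a ≤ x^{1/3}`. -/
theorem le_rpow_third_of_cube_le {a x : ℝ} (ha : 0 ≤ a) (h : a ^ 3 ≤ x) : a ≤ x ^ ((1 : ℝ) / 3) := by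
  have hx : 0 ≤ x := le_trans (by positivity) h
  calc a = (a ^ 3) ^ ((1 : ℝ) / 3) := by
        rw [← Real.rpow_natCast a 3, ← Real.rpow_mul ha]; norm_num
    _ ≤ x ^ ((1 : ℝ) / 3) := Real.rpow_le_rpow (by positivity) h (by norm_num)

/-- **Concavity step of the two-class rung.**  For `V = v₁ + v₂` with `v₁, v₂ ≥ (3/20)·V`:
`((17/20)^{2/3} + (3/20)^{2/3}) · V^{2/3} ≤ v₁^{2/3} + v₂^{2/3}`. -/
theorem rpow_two_thirds_two_classes {V v₁ v₂ : ℝ} (hV : V = v₁ + v₂) (h1 : 3 / 20 * V ≤ v₁)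
    (h2 : 3 / 20 * V ≤ v₂) :
    ((17 / 20 : ℝ) ^ ((2 : ℝ) / 3) + (3 / 20 : ℝ) ^ ((2 : ℝ) / 3)) * V ^ ((2 : ℝ) / 3) ≤
      v₁ ^ ((2 : ℝ) / 3) + v₂ ^ ((2 : ℝ) / 3) := by
  have hV0 : 0 ≤ V := by nlinarith
  rcases hV0.eq_or_lt with hV00 | hVpos
  · -- `V = 0`: everything vanishes
    have hv1 : v₁ = 0 := by nlinarith
    have hv2 : v₂ = 0 := by nlinarith
    rw [← hV00, hv1, hv2, Real.zero_rpow (by norm_num)]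
    simp
  have hv1 : 0 ≤ v₁ := le_trans (by positivity) h1
  have hv2 : 0 ≤ v₂ := le_trans (by positivity) h2
  -- `v₁ = λ (17/20 V) + (1 − λ)(3/20 V)`, `v₂ = λ (3/20 V) + (1 − λ)(17/20 V)`
  set μ : ℝ := (v₁ - 3 / 20 * V) / (14 / 20 * V) with hμ
  have hden : 0 < 14 / 20 * V := by positivity
  have hμ0 : 0 ≤ μ := div_nonneg (by linarith) hden.le
  have hμ1 : μ ≤ 1 := (div_le_one hden).2 (by linarith)
  have hμv : μ * (14 / 20 * V) = v₁ - 3 / 20 * V := div_mul_cancel₀ _ hden.ne'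
  have e1 : μ * (17 / 20 * V) + (1 - μ) * (3 / 20 * V) = v₁ := by linarith
  have e2 : μ * (3 / 20 * V) + (1 - μ) * (17 / 20 * V) = v₂ := by linarith
  have hconc := (Real.concaveOn_rpow (p := (2 : ℝ) / 3) (by norm_num) (by norm_num)).2
  have h17m : (17 / 20 * V) ∈ Set.Ici (0 : ℝ) := Set.mem_Ici.2 (by positivity)
  have h3m : (3 / 20 * V) ∈ Set.Ici (0 : ℝ) := Set.mem_Ici.2 (by positivity)
  have hA : μ * (17 / 20 * V) ^ ((2 : ℝ) / 3) + (1 - μ) * (3 / 20 * V) ^ ((2 : ℝ) / 3) ≤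
      v₁ ^ ((2 : ℝ) / 3) := by
    have h := hconc h17m h3m hμ0 (sub_nonneg.2 hμ1) (by ring)
    simp only [smul_eq_mul] at h
    rwa [e1] at h
  have hB : μ * (3 / 20 * V) ^ ((2 : ℝ) / 3) + (1 - μ) * (17 / 20 * V) ^ ((2 : ℝ) / 3) ≤
      v₂ ^ ((2 : ℝ) / 3) := by
    have h := hconc h3m h17m hμ0 (sub_nonneg.2 hμ1) (by ring)
    simp only [smul_eq_mul] at h
    rwa [e2] at h
  have e17 : (17 / 20 * V) ^ ((2 : ℝ) / 3) = (17 / 20 : ℝ) ^ ((2 : ℝ) / 3) * V ^ ((2 : ℝ) / 3) :=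
    Real.mul_rpow (by norm_num) hV0
  have e3 : (3 / 20 * V) ^ ((2 : ℝ) / 3) = (3 / 20 : ℝ) ^ ((2 : ℝ) / 3) * V ^ ((2 : ℝ) / 3) :=
    Real.mul_rpow (by norm_num) hV0
  rw [e17, e3] at hA hB
  nlinarith [hA, hB]

/-- **Two-class corner (arithmetic of `rung_twinFree_twoClasses`, balanced case).**  Let
`V = v₁ + v₂` with both `v_i ≥ (3/20)·V`, `V_K ≥ 27.5`, `D ≥ 0`, and an energy `En` with
`3·V_K^{1/3}·V^{2/3} + D/2 ≤ En` (intersection-body bound plus walls) and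
`w(v₁) + w(v₂) − (√5 − 1/2)·D ≤ En` (second pincer), `w(v) = 6·2^{1/3}(√2 v)^{2/3}`.
Then `w(V) ≤ En`. -/
theorem twoClass_arith {V v₁ v₂ VK D En : ℝ} (hV : V = v₁ + v₂) (h1 : 3 / 20 * V ≤ v₁)
    (h2 : 3 / 20 * V ≤ v₂) (hVK : (27.5 : ℝ) ≤ VK) (hD : 0 ≤ D)
    (hK : 3 * VK ^ ((1 : ℝ) / 3) * V ^ ((2 : ℝ) / 3) + D / 2 ≤ En)
    (hP : 6 * (2 : ℝ) ^ ((1 : ℝ) / 3) * (Real.sqrt 2 * v₁) ^ ((2 : ℝ) / 3) +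
      6 * (2 : ℝ) ^ ((1 : ℝ) / 3) * (Real.sqrt 2 * v₂) ^ ((2 : ℝ) / 3) -
        (Real.sqrt 5 - 1 / 2) * D ≤ En) :
    6 * (2 : ℝ) ^ ((1 : ℝ) / 3) * (Real.sqrt 2 * V) ^ ((2 : ℝ) / 3) ≤ En := by
  have hV0 : 0 ≤ V := by nlinarith
  have hv1 : 0 ≤ v₁ := le_trans (by positivity) h1
  have hv2 : 0 ≤ v₂ := le_trans (by positivity) h2
  rw [wulffConstant_eq' hV0]
  rw [wulffConstant_eq' hv1, wulffConstant_eq' hv2] at hP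
  obtain ⟨ht1, ht2, -⟩ := cbrt_two_bounds
  set t : ℝ := (2 : ℝ) ^ ((1 : ℝ) / 3) with ht
  have ht0 : 0 ≤ t := by positivity
  -- the concavity step
  have hkey := rpow_two_thirds_two_classes hV h1 h2
  have h17 := rpow_seventeen_twentieths_lower
  have h3 := rpow_three_twentieths_lower
  set W : ℝ := V ^ ((2 : ℝ) / 3) with hW
  set W1 : ℝ := v₁ ^ ((2 : ℝ) / 3) with hW1
  set W2 : ℝ := v₂ ^ ((2 : ℝ) / 3) with hW2
  have hW0 : 0 ≤ W := by positivity
  have hW10 : 0 ≤ W1 := by positivity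
  have hW20 : 0 ≤ W2 := by positivity
  have hsum : (1.1796 : ℝ) * W ≤ W1 + W2 := by nlinarith [hkey, h17, h3, hW0]
  -- the cube root of `V_K`
  have hcbrt : (3.018 : ℝ) ≤ VK ^ ((1 : ℝ) / 3) :=
    le_rpow_third_of_cube_le (by norm_num) (le_trans (by norm_num) hVK)
  -- decimal brackets
  have h5l : (2.236 : ℝ) ≤ Real.sqrt 5 := sqrt_five_lower'
  have h5u : Real.sqrt 5 ≤ (2.2361 : ℝ) := sqrt_five_upper
  have ht2l : (1.2599 : ℝ) ^ 2 ≤ t ^ 2 := by gcongr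
  have ht2u : t ^ 2 ≤ (1.25993 : ℝ) ^ 2 := by gcongr
  -- products, as linear facts
  have p1 : (3.018 : ℝ) * W ≤ VK ^ ((1 : ℝ) / 3) * W := mul_le_mul_of_nonneg_right hcbrt hW0
  have p2 : (1.2599 : ℝ) ^ 2 * (W1 + W2) ≤ t ^ 2 * (W1 + W2) :=
    mul_le_mul_of_nonneg_right ht2l (by positivity)
  have p3 : t ^ 2 * W ≤ (1.25993 : ℝ) ^ 2 * W := mul_le_mul_of_nonneg_right ht2u hW0
  have p4 : (Real.sqrt 5 - 1 / 2) * D ≤ (2.2361 - 1 / 2) * D :=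
    mul_le_mul_of_nonneg_right (by linarith) hD
  -- eliminate `D` with weights `(2√5 − 1) : 1`, in decimal form `3.472 : 1`
  nlinarith [hK, hP, p1, p2, p3, p4, hsum, hD, hW0, hW10, hW20, sq_nonneg t,
    mul_le_mul_of_nonneg_right h5l (by positivity : (0 : ℝ) ≤ VK ^ ((1 : ℝ) / 3) * W)]

end Summit.Ventures.Crystal3D.Theorems

end
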